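import Literature.NumberTheory.LFunctions.WeilTwoPrimeDeflM72YBase
import Literature.NumberTheory.LFunctions.WeilBlockRowsFast
import HarnessLib

/-!
# Deflated two-prime certificate M72Y: the odd Bessel block claim `Hp = C H Cᵀ`, rows 75–79 (fast linear-traversal check)

The rows are checked with `WeilCert.checkHpRowT` (linear traversals, triangular storage of `weilCert23HC`) instead of the
indexed `checkHpRow` decide.  Pure proof file.
-/

noncomputable section

namespace Literature.NumberTheory.LFunctions

set_option maxHeartbeats 0 in
/-- Fast kernel check of claim row 75 of `Hp = C H Cᵀ` (odd block, certificate M72Y; triangular `C`). [folklore] -/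
theorem checkHpRowT1_75_weilCertDeflM72Y : weilCertDeflM72YBase.checkHpRowT weilCertDeflM72YHpO 1 75 = true := by
  decide +kernel

/-- Claim row 75 of `Hp = C H Cᵀ` (odd block, certificate M72Y), from the fast check. [folklore] -/
theorem checkHpRow1_75_weilCertDeflM72Y : weilCertDeflM72YBase.checkHpRow weilCertDeflM72YHpO 1 75 = true :=
  WeilCert.checkHpRow_of_T checkHpRowT1_75_weilCertDeflM72Y

set_option maxHeartbeats 0 in
/-- Fast kernel check of claim row 76 of `Hp = C H Cᵀ` (odd block, certificate M72Y; triangular `C`). [folklore] -/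
theorem checkHpRowT1_76_weilCertDeflM72Y : weilCertDeflM72YBase.checkHpRowT weilCertDeflM72YHpO 1 76 = true := by
  decide +kernel

/-- Claim row 76 of `Hp = C H Cᵀ` (odd block, certificate M72Y), from the fast check. [folklore] -/
theorem checkHpRow1_76_weilCertDeflM72Y : weilCertDeflM72YBase.checkHpRow weilCertDeflM72YHpO 1 76 = true :=
  WeilCert.checkHpRow_of_T checkHpRowT1_76_weilCertDeflM72Y

set_option maxHeartbeats 0 in
/-- Fast kernel check of claim row 77 of `Hp = C H Cᵀ` (odd block, certificate M72Y; triangular `C`). [folklore] -/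
theorem checkHpRowT1_77_weilCertDeflM72Y : weilCertDeflM72YBase.checkHpRowT weilCertDeflM72YHpO 1 77 = true := by
  decide +kernel

/-- Claim row 77 of `Hp = C H Cᵀ` (odd block, certificate M72Y), from the fast check. [folklore] -/
theorem checkHpRow1_77_weilCertDeflM72Y : weilCertDeflM72YBase.checkHpRow weilCertDeflM72YHpO 1 77 = true :=
  WeilCert.checkHpRow_of_T checkHpRowT1_77_weilCertDeflM72Y

set_option maxHeartbeats 0 in
/-- Fast kernel check of claim row 78 of `Hp = C H Cᵀ` (odd block, certificate M72Y; triangular `C`). [folklore] -/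
theorem checkHpRowT1_78_weilCertDeflM72Y : weilCertDeflM72YBase.checkHpRowT weilCertDeflM72YHpO 1 78 = true := by
  decide +kernel

/-- Claim row 78 of `Hp = C H Cᵀ` (odd block, certificate M72Y), from the fast check. [folklore] -/
theorem checkHpRow1_78_weilCertDeflM72Y : weilCertDeflM72YBase.checkHpRow weilCertDeflM72YHpO 1 78 = true :=
  WeilCert.checkHpRow_of_T checkHpRowT1_78_weilCertDeflM72Y

set_option maxHeartbeats 0 in
/-- Fast kernel check of claim row 79 of `Hp = C H Cᵀ` (odd block, certificate M72Y; triangular `C`). [folklore] -/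
theorem checkHpRowT1_79_weilCertDeflM72Y : weilCertDeflM72YBase.checkHpRowT weilCertDeflM72YHpO 1 79 = true := by
  decide +kernel

/-- Claim row 79 of `Hp = C H Cᵀ` (odd block, certificate M72Y), from the fast check. [folklore] -/
theorem checkHpRow1_79_weilCertDeflM72Y : weilCertDeflM72YBase.checkHpRow weilCertDeflM72YHpO 1 79 = true :=
  WeilCert.checkHpRow_of_T checkHpRowT1_79_weilCertDeflM72Y

end Literature.NumberTheory.LFunctions
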